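import Mathlib.LinearAlgebra.Matrix.Polynomial
import Mathlib.LinearAlgebra.Matrix.NonsingularInverse
import Mathlib.LinearAlgebra.FiniteDimensional.Lemmas
import Mathlib.LinearAlgebra.Dimension.Constructions
import Mathlib.LinearAlgebra.Projection
import Mathlib.Algebra.Polynomial.Roots
import HarnessLib

/-!
# Affine pencils of linear maps: the rank dichotomy for the fibres of `w₀`

Topic `Literature/LinearAlgebra/Subspace`. Let `K` be an infinite field, `V`, `W` finite-dimensional
`K`-spaces, `M(a) = M₀ + a M₁ : V → W` (`a ∈ K`) an affine pencil of linear maps and `w₀ ∈ W`.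
Put `G = {a : w₀ ∉ im M(a)}` ("good" parameters). **Then either `G` or its complement has at most
`dim W` elements** (`rank_dichotomy`). This is the linear-algebra form of the fact that the image
of a variety under the projection to a line is finite or cofinite, with an explicit bound, used for
one-parameter families of Macaulay-type matrices (emptiness of the fibre `Y_j = a` of a polynomial
system being, by an effective Nullstellensatz, the solvability of `1 = ∑ g_i f_i + g_0 (Y_j - a)`
in bounded degree). Proof: the maximal rank `r` of `M(a)` is attained outside the zeros of a
nonzero polynomial `D` of degree `≤ r` (an `r × r` minor, `exists_det_witness`); the same for the
augmented pencil `M'(a)(x, c) = M(a) x + c w₀`, whose rank is `rank M(a) + [w₀ ∉ im M(a)]`; if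
`G` is infinite some `a ∈ G` has `rank M(a) = r`, so `r' = r + 1` and every bad `a` is a zero of
`D'`; if `G` is finite some bad `a` realises both maxima, so `r' = r` and every good `a` is a zero
of `D`. Everything here is standard linear algebra; we know no reference stating it in this form.

## Contents (namespace `Literature.LinearAlgebra.Subspace`, everything proved)

* `finrank_sup_span_singleton_of_not_mem`, `sup_span_singleton_of_mem` — `dim (U + K w₀)`;
* `exists_det_witness` — the minor polynomial of an affine pencil;
* `rank_dichotomy` — the dichotomy.
-/

noncomputable section

open Polynomial Module
open scoped Classical

namespace Literature.LinearAlgebra.Subspace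

variable {K : Type*} [Field K] {V W : Type*} [AddCommGroup V] [Module K V] [AddCommGroup W]
  [Module K W] [FiniteDimensional K V] [FiniteDimensional K W]

/-! ### `dim (U + K w₀)` -/

omit [FiniteDimensional K V] [FiniteDimensional K W] in
/-- If `w₀ ∈ U` then `U + K w₀ = U`. [folklore] -/
theorem sup_span_singleton_of_mem {U : Submodule K W} {w₀ : W} (h : w₀ ∈ U) :
    U ⊔ Submodule.span K {w₀} = U :=
  sup_eq_left.2 ((Submodule.span_singleton_le_iff_mem _ _).2 h)

/-- If `w₀ ∉ U` then `dim (U + K w₀) = dim U + 1` — this is Mathlib's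
`Submodule.finrank_sup_span_singleton` (`Mathlib/LinearAlgebra/FiniteDimensional/Lemmas.lean`);
kept as a deprecated alias (librarian sweep g24, pass 2). [folklore] -/
@[deprecated Submodule.finrank_sup_span_singleton (since := "2026-08-16")]
alias finrank_sup_span_singleton_of_not_mem := Submodule.finrank_sup_span_singleton

/-! ### The minor polynomial of an affine pencil -/

/-- The affine pencil `M(a) = M₀ + a M₁`. [folklore] -/
def pencil (M₀ M₁ : V →ₗ[K] W) (a : K) : V →ₗ[K] W := M₀ + a • M₁

/-- The rank of `M(a)`. [folklore] -/
def rk (M₀ M₁ : V →ₗ[K] W) (a : K) : ℕ := finrank K (LinearMap.range (pencil M₀ M₁ a))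

omit [FiniteDimensional K V] in
/-- `rank M(a) ≤ dim W`. [folklore] -/
theorem rk_le (M₀ M₁ : V →ₗ[K] W) (a : K) : rk M₀ M₁ a ≤ finrank K W :=
  Submodule.finrank_le _

/-- The maximal rank of the pencil. [folklore] -/
def maxRk (M₀ M₁ : V →ₗ[K] W) : ℕ :=
  Nat.findGreatest (fun m => ∃ a, rk M₀ M₁ a = m) (finrank K W)

omit [FiniteDimensional K V] in
/-- `rank M(a) ≤ r`. [folklore] -/
theorem rk_le_maxRk (M₀ M₁ : V →ₗ[K] W) (a : K) : rk M₀ M₁ a ≤ maxRk M₀ M₁ :=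
  Nat.le_findGreatest (rk_le M₀ M₁ a) ⟨a, rfl⟩

omit [FiniteDimensional K V] in
/-- The maximal rank is attained. [folklore] -/
theorem exists_rk_eq_maxRk (M₀ M₁ : V →ₗ[K] W) : ∃ a, rk M₀ M₁ a = maxRk M₀ M₁ :=
  Nat.findGreatest_spec (P := fun m => ∃ a, rk M₀ M₁ a = m) (rk_le M₀ M₁ 0) ⟨0, rfl⟩

omit [FiniteDimensional K V] [FiniteDimensional K W] in
/-- `r ≤ dim W`. [folklore] -/
theorem maxRk_le (M₀ M₁ : V →ₗ[K] W) : maxRk M₀ M₁ ≤ finrank K W :=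
  Nat.findGreatest_le _

/-- **The minor polynomial.** For an affine pencil `M(a) = M₀ + a M₁` of maximal rank `r` there is
a nonzero polynomial `D` of degree `≤ r` such that `rank M(a) = r` whenever `D(a) ≠ 0` (take `a₀`
of rank `r`, `v_1, …, v_r` with `M(a₀) v_j` independent, a projection `p : W → K^r` sending
`M(a₀) v_j` to the standard basis, and `D(a) = det (p (M(a) v_j))_{ij}`). [folklore] -/
theorem exists_det_witness (M₀ M₁ : V →ₗ[K] W) :
    ∃ D : K[X], D ≠ 0 ∧ D.natDegree ≤ maxRk M₀ M₁ ∧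
      ∀ a, D.eval a ≠ 0 → rk M₀ M₁ a = maxRk M₀ M₁ := by
  classical
  obtain ⟨a₀, ha₀⟩ := exists_rk_eq_maxRk M₀ M₁
  set r := maxRk M₀ M₁ with hr
  -- a basis of `range M(a₀)` of the form `M(a₀) v_j`
  set U : Submodule K W := LinearMap.range (pencil M₀ M₁ a₀) with hU
  have hUr : finrank K U = r := ha₀
  let bU : Basis (Fin r) K U := finBasisOfFinrankEq K U hUr
  have hmem : ∀ j, (bU j : W) ∈ LinearMap.range (pencil M₀ M₁ a₀) := fun j => (bU j).2
  choose v hv using fun j => LinearMap.mem_range.1 (hmem j)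
  -- the family `b j = M(a₀) v_j` is independent
  set b : Fin r → W := fun j => pencil M₀ M₁ a₀ (v j) with hb
  have hbU : ∀ j, b j = (bU j : W) := fun j => hv j
  have hbli : LinearIndependent K b := by
    have h1 : LinearIndependent K (fun j => (bU j : W)) :=
      bU.linearIndependent.map' U.subtype U.ker_subtype
    convert h1 using 1
    exact funext hbU
  -- a projection `p : W → (Fin r → K)` with `p (b j) = e_j`
  set S : Submodule K W := Submodule.span K (Set.range b) with hS
  let bS : Basis (Fin r) K S := Basis.span hbli
  obtain ⟨S', hSS'⟩ := S.exists_isCompl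
  let q : W →ₗ[K] S := Submodule.projectionOnto S S' hSS'
  let p : W →ₗ[K] (Fin r → K) :=
    (Finsupp.linearEquivFunOnFinite K K (Fin r)).toLinearMap.comp (bS.repr.toLinearMap.comp q)
  have hp : ∀ j, p (b j) = Pi.single j 1 := by
    intro j
    have hq : q (b j) = bS j := by
      have hbj : b j = (bS j : W) := by rw [Basis.span_apply]
      have : q (bS j : W) = bS j := Submodule.projectionOnto_apply_left hSS' (bS j)
      rw [hbj, this]
    simp only [p, LinearMap.comp_apply, LinearEquiv.coe_toLinearMap, hq, Basis.repr_self]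
    ext i
    simp [Finsupp.single_apply, Pi.single_apply, eq_comm]
  -- the polynomial matrix
  let A : Matrix (Fin r) (Fin r) K := Matrix.of fun i j => p (M₁ (v j)) i
  let B : Matrix (Fin r) (Fin r) K := Matrix.of fun i j => p (M₀ (v j)) i
  let P : Matrix (Fin r) (Fin r) K[X] := (Polynomial.X : K[X]) • A.map Polynomial.C + B.map Polynomial.C
  refine ⟨P.det, ?_, (natDegree_det_X_add_C_le A B).trans (Fintype.card_fin r).le, ?_⟩
  · -- `D(a₀) = det 1 = 1`
    have hmat : ∀ a, (Polynomial.evalRingHom a).mapMatrix P =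
        Matrix.of fun i j => p (pencil M₀ M₁ a (v j)) i := by
      intro a
      ext i j
      simp only [P, A, B, pencil, RingHom.mapMatrix_apply, Matrix.map_apply, Matrix.add_apply,
        Matrix.smul_apply, Matrix.of_apply, smul_eq_mul, Polynomial.coe_evalRingHom,
        eval_mul, eval_X, eval_C, LinearMap.add_apply, LinearMap.smul_apply, map_add, map_smul,
        Pi.add_apply, Pi.smul_apply, mul_comm a]
      ring
    intro hD
    have h := RingHom.map_det (Polynomial.evalRingHom a₀) P
    rw [hD, map_zero, hmat a₀] at h
    have hone : (Matrix.of fun i j => p (pencil M₀ M₁ a₀ (v j)) i) = (1 : Matrix (Fin r) (Fin r) K) := by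
      ext i j
      change p (b j) i = _
      rw [hp j, Matrix.one_apply, Pi.single_apply]
    rw [hone, Matrix.det_one] at h
    exact one_ne_zero h.symm
  · intro a ha
    refine le_antisymm (rk_le_maxRk M₀ M₁ a) ?_
    -- `det (p (M(a) v_j)) ≠ 0`, so the `M(a) v_j` are independent
    have hmat : (Polynomial.evalRingHom a).mapMatrix P =
        Matrix.of fun i j => p (pencil M₀ M₁ a (v j)) i := by
      ext i j
      simp only [P, A, B, pencil, RingHom.mapMatrix_apply, Matrix.map_apply, Matrix.add_apply,
        Matrix.smul_apply, Matrix.of_apply, smul_eq_mul, Polynomial.coe_evalRingHom,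
        eval_mul, eval_X, eval_C, LinearMap.add_apply, LinearMap.smul_apply, map_add, map_smul,
        Pi.add_apply, Pi.smul_apply, mul_comm a]
      ring
    have hdet : (Matrix.of fun i j => p (pencil M₀ M₁ a (v j)) i).det ≠ 0 := by
      rw [← hmat, ← RingHom.map_det]; exact ha
    have hcols : LinearIndependent K (fun j => p (pencil M₀ M₁ a (v j))) := by
      exact Matrix.linearIndependent_cols_iff_isUnit.2
        ((Matrix.isUnit_iff_isUnit_det _).2 (isUnit_iff_ne_zero.2 hdet))
    have hli : LinearIndependent K (fun j => pencil M₀ M₁ a (v j)) := LinearIndependent.of_comp p hcols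
    have hspan : Submodule.span K (Set.range fun j => pencil M₀ M₁ a (v j)) ≤
        LinearMap.range (pencil M₀ M₁ a) := by
      rw [Submodule.span_le]; rintro _ ⟨j, rfl⟩; exact LinearMap.mem_range_self _ _
    calc r = finrank K ↥(Submodule.span K (Set.range fun j => pencil M₀ M₁ a (v j))) := by
          rw [finrank_span_eq_card hli, Fintype.card_fin]
      _ ≤ rk M₀ M₁ a := Submodule.finrank_mono hspan

/-! ### The dichotomy -/

omit [FiniteDimensional K V] [FiniteDimensional K W] in
/-- The augmented pencil `M'(a)(x, c) = M(a) x + c w₀`. [folklore] -/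
theorem pencil_coprod (M₀ M₁ : V →ₗ[K] W) (w₀ : W) (a : K) :
    pencil (M₀.coprod (LinearMap.toSpanSingleton K W w₀)) (M₁.coprod 0) a =
      (pencil M₀ M₁ a).coprod (LinearMap.toSpanSingleton K W w₀) := by
  apply LinearMap.ext
  rintro ⟨x, c⟩
  simp only [pencil, LinearMap.coprod_apply, LinearMap.add_apply, LinearMap.smul_apply,
    LinearMap.zero_apply, add_zero]
  abel

omit [FiniteDimensional K V] [FiniteDimensional K W] in
/-- `im M'(a) = im M(a) + K w₀`. [folklore] -/
theorem range_pencil_coprod (M₀ M₁ : V →ₗ[K] W) (w₀ : W) (a : K) :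
    LinearMap.range (pencil (M₀.coprod (LinearMap.toSpanSingleton K W w₀)) (M₁.coprod 0) a) =
      LinearMap.range (pencil M₀ M₁ a) ⊔ Submodule.span K {w₀} := by
  rw [pencil_coprod, LinearMap.range_coprod, LinearMap.span_singleton_eq_range]

omit [FiniteDimensional K V] in
/-- `rank M'(a) = rank M(a) + [w₀ ∉ im M(a)]`. [folklore] -/
theorem rk_coprod (M₀ M₁ : V →ₗ[K] W) (w₀ : W) (a : K) :
    rk (M₀.coprod (LinearMap.toSpanSingleton K W w₀)) (M₁.coprod 0) a =
      rk M₀ M₁ a + (if w₀ ∈ LinearMap.range (pencil M₀ M₁ a) then 0 else 1) := by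
  unfold rk
  rw [range_pencil_coprod]
  split_ifs with h
  · rw [sup_span_singleton_of_mem h, add_zero]
  · exact Submodule.finrank_sup_span_singleton h

variable [Infinite K]

/-- **The rank dichotomy for the fibres of `w₀` under an affine pencil.** For finite-dimensional
`V, W` over an infinite field, `M(a) = M₀ + a M₁ : V → W` and `w₀ ∈ W`, let
`G = {a : w₀ ∉ im M(a)}`. Then either `G` is finite with at most `dim W` elements, or the
complement of `G` is finite with at most `dim W` elements. [folklore] -/
theorem rank_dichotomy (M₀ M₁ : V →ₗ[K] W) (w₀ : W) :
    (∃ T : Finset K, T.card ≤ finrank K W ∧ ∀ a, w₀ ∉ LinearMap.range (pencil M₀ M₁ a) → a ∈ T) ∨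
    (∃ T : Finset K, T.card ≤ finrank K W ∧ ∀ a, w₀ ∈ LinearMap.range (pencil M₀ M₁ a) → a ∈ T) := by
  classical
  set G : Set K := {a | w₀ ∉ LinearMap.range (pencil M₀ M₁ a)} with hG
  obtain ⟨D, hD0, hDdeg, hD⟩ := exists_det_witness M₀ M₁
  obtain ⟨D', hD'0, hD'deg, hD'⟩ :=
    exists_det_witness (M₀.coprod (LinearMap.toSpanSingleton K W w₀)) (M₁.coprod 0)
  set r := maxRk M₀ M₁ with hr
  set r' := maxRk (M₀.coprod (LinearMap.toSpanSingleton K W w₀)) (M₁.coprod 0) with hr'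
  have hroots : ∀ {E : K[X]}, E ≠ 0 → ∀ a, E.eval a = 0 → a ∈ E.roots.toFinset := fun hE a ha => by
    rw [Multiset.mem_toFinset, mem_roots hE]; exact ha
  have hcard : ∀ (E : K[X]), E.roots.toFinset.card ≤ E.natDegree := fun E =>
    (Multiset.toFinset_card_le _).trans (card_roots' E)
  by_cases hfin : G.Finite
  · -- `G` finite: the bad set is infinite; some bad `b` realises both maxima, so `r' = r`
    left
    have hbad : (Gᶜ).Infinite := fun h => Set.infinite_univ (by simpa using hfin.union h)
    obtain ⟨b, hbG, hbT⟩ := hbad.exists_notMem_finset (D.roots.toFinset ∪ D'.roots.toFinset)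
    rw [Finset.mem_union, not_or] at hbT
    have hDb : D.eval b ≠ 0 := fun h => hbT.1 (hroots hD0 b h)
    have hD'b : D'.eval b ≠ 0 := fun h => hbT.2 (hroots hD'0 b h)
    have hbmem : w₀ ∈ LinearMap.range (pencil M₀ M₁ b) := by
      simpa [hG] using hbG
    have hrr' : r' = r := by
      rw [← hD' b hD'b, ← hD b hDb, rk_coprod, if_pos hbmem, add_zero]
    refine ⟨D.roots.toFinset, (hcard D).trans (hDdeg.trans (maxRk_le _ _)), fun a ha => ?_⟩
    refine hroots hD0 a ?_
    by_contra hne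
    have h1 := hD a hne
    have h2 := rk_le_maxRk (M₀.coprod (LinearMap.toSpanSingleton K W w₀)) (M₁.coprod 0) a
    rw [rk_coprod, if_neg ha, h1, ← hr', hrr'] at h2
    omega
  · -- `G` infinite: some good `a` has `rank M(a) = r`, so `r' = r + 1`
    right
    obtain ⟨a, haG, haT⟩ := Set.Infinite.exists_notMem_finset hfin D.roots.toFinset
    have hDa : D.eval a ≠ 0 := fun h => haT (hroots hD0 a h)
    have hanot : w₀ ∉ LinearMap.range (pencil M₀ M₁ a) := haG
    have hr'r : r + 1 ≤ r' := by
      have h := rk_le_maxRk (M₀.coprod (LinearMap.toSpanSingleton K W w₀)) (M₁.coprod 0) a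
      rwa [rk_coprod, if_neg hanot, hD a hDa] at h
    refine ⟨D'.roots.toFinset, (hcard D').trans (hD'deg.trans (maxRk_le _ _)), fun c hc => ?_⟩
    refine hroots hD'0 c ?_
    by_contra hne
    have h1 := hD' c hne
    rw [rk_coprod, if_pos hc, add_zero] at h1
    have h2 := rk_le_maxRk M₀ M₁ c
    rw [h1] at h2
    omega

end Literature.LinearAlgebra.Subspace

end
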